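import Literature.NumberTheory.Transcendental.KZCalculus
import HarnessLib

/-!
# Sub-calculi of the Kontsevich–Zagier calculus generated by admissible move data

Groundwork for definition request D2 (`KZ.localRelations S`, "Conjecture 1 over `Spec ℤ[1/S]`")
of the route `Summits/KontsevichZagierPeriods/KontsevichZagierPeriods/Theses/PeriodConductors`.
The four move sets of `KZCalculus.lean` (`KZ.domainAddRel`, `integrandAddRel`,
`changeOfVariablesRel`, `newtonLeibnizRel : Set KZ.FormalRep`; Kontsevich–Zagier 2001, §1.2, rules
(1)–(3)) hide their data behind existential quantifiers. A sub-calculus "generated by the move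
instances all of whose data satisfy a condition" (D2: arrangement conductor `⊆ S`) needs the data
as first-class objects. This file provides exactly that, with no named facts:

* `KZ.DomainAddDatum`, `KZ.IntegrandAddDatum`, `KZ.ChangeOfVariablesDatum`,
  `KZ.NewtonLeibnizDatum` (**structures**): the data and side conditions of one instance of move
  (1a), (1b), (2), (3), verbatim the bodies of the four move sets; `δ.rel : FormalRep` is the
  relation the instance produces (`[r] − [r₁] − [r₂]`, resp. `[r] − [r']`), and
  `domainAddRel_eq_range` etc. identify each move set with the range of `rel` (**proved**).
* `KZ.MoveDatum` (**inductive**, the disjoint union of the four) with `MoveDatum.rel`;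
  `range_moveDatumRel` (= the union of the four move sets) and `relations_eq_closure_range`
  (`KZ.relations` is the subgroup generated by the `δ.rel`) (**proved**).
* `KZ.localRelationsOf (adm : Set MoveDatum) : AddSubgroup FormalRep` (**definition**): the
  sub-calculus generated by the admissible move instances; API `localRelationsOf_le_relations`,
  `localRelationsOf_mono`, `localRelationsOf_univ` (`= relations`), `localRelationsOf_iUnion`
  (`⨆ᵢ` of the sub-calculi of `adm i` is the sub-calculus of `⋃ᵢ adm i`), `rel_mem_localRelationsOf`.
* `KZ.LocallyEquivalentOf adm r r'` (**definition**): `[r] − [r'] ∈ localRelationsOf adm`;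
  `refl`/`symm`/`trans`, `mono`, `.equivalent` (implies `KZ.Equivalent`).
* `KZ.localRelationsOfConductor (cond : MoveDatum → Set ℕ) (S : Finset ℕ)` (**definition**): the
  sub-calculus of the instances with `cond δ ⊆ S`, for an ARBITRARY conductor-like invariant of
  move data; API `localRelationsOfConductor_mono` (in `S`), `localRelationsOfConductor_le_relations`,
  and `iSup_localRelationsOfConductor` (**proved**): if every `cond δ` is finite then
  `⨆_S localRelationsOfConductor cond S = relations` — the three lemmas D2 asks for, generically.

What is NOT here (and why): D2 proper, `KZ.localRelations S := localRelationsOfConductor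
KZ.arrangementConductorOfDatum S`, needs the arrangement conductor of GENERAL move data (request
D1: primes of bad reduction of the flat closure of walls ∪ poles ∪ `H_∞`, of the graph of `Φ`, of
the graph and zero/pole loci of `F`, `a`, `b`). D1 has been delivered only at the elementary level
(points on `ℙ¹`, linear cells: proposal `KZArrangementConductor.lean`), not for general
`ℚ`-semialgebraic data, for which the tree has no reduction-type carrier. Once a
`cond : MoveDatum → Set ℕ` with finite values exists, D2 and its API are the one-liners above.

## Design notes

* The structures copy the move sets' fields in the same order, so `rel_mem` / `_eq_range` are
  definitional repackagings (`⟨_, …, rfl⟩`); nothing about the calculus is restated or changed.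
* `MoveDatum` is a plain inductive (four constructors) rather than nested sums, for readable
  pattern matching; the dimension `n` is a field of each datum.
* `localRelationsOf` is `AddSubgroup.closure (MoveDatum.rel '' adm)`; all API is `closure_mono` /
  `closure_iUnion` bookkeeping (Mathlib `AddSubgroup.closure_mono`, `AddSubgroup.closure_iUnion`,
  `Set.image_iUnion`).
* Imports: `KZCalculus` only.

## References

* M. Kontsevich, D. Zagier, *Periods*, in: Mathematics Unlimited — 2001 and Beyond, Springer
  (2001), 771–808, §1.2 (the rules (1) additivity, (2) change of variables, (3) Newton–Leibniz).
  [KontsevichZagierPeriods2001]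
* A. Huber, S. Müller-Stach, *Periods and Nori Motives*, Springer (2017), §13.1.
  [HuberMullerStachPeriods2017]
-/

noncomputable section

open MeasureTheory Set

namespace Literature.NumberTheory.Transcendental

namespace KZ

/-! ### Move data as first-class objects -/

/-- **Data of an instance of move (1a), additivity in the domain** (Kontsevich–Zagier 2001,
§1.2, rule (1)): three representations `r`, `r₁`, `r₂` in a common dimension `n` with
`σ = σ₁ ∪ σ₂`, `σ₁ ∩ σ₂` Lebesgue-null and the integrands of `r₁`, `r₂` agreeing with that of `r`
on their domains — verbatim the body of `KZ.domainAddRel`. [cite: KontsevichZagierPeriods2001, §1.2 rule (1)] -/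
structure DomainAddDatum where
  /-- The common dimension. -/
  n : ℕ
  /-- The representation being cut. -/
  r : IntegralRep n
  /-- The first piece. -/
  r₁ : IntegralRep n
  /-- The second piece. -/
  r₂ : IntegralRep n
  /-- `σ = σ₁ ∪ σ₂`. -/
  domain_eq : r.domain = r₁.domain ∪ r₂.domain
  /-- `σ₁ ∩ σ₂` is null. -/
  volume_inter : volume (r₁.domain ∩ r₂.domain) = 0
  /-- The integrands agree on `σ₁`. -/
  eqOn₁ : EqOn r.integrand r₁.integrand r₁.domain
  /-- The integrands agree on `σ₂`. -/
  eqOn₂ : EqOn r.integrand r₂.integrand r₂.domain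

/-- The relation `[r] − [r₁] − [r₂]` produced by an instance of move (1a).
[cite: KontsevichZagierPeriods2001, §1.2 rule (1)] -/
def DomainAddDatum.rel (δ : DomainAddDatum) : FormalRep := of δ.r - of δ.r₁ - of δ.r₂

/-- The move set (1a) is the range of `DomainAddDatum.rel` (definitional repackaging).
[cite: KontsevichZagierPeriods2001, §1.2 rule (1)] -/
theorem domainAddRel_eq_range : domainAddRel = Set.range DomainAddDatum.rel := by
  ext c
  constructor
  · rintro ⟨n, r, r₁, r₂, h₁, h₂, h₃, h₄, rfl⟩
    exact ⟨⟨n, r, r₁, r₂, h₁, h₂, h₃, h₄⟩, rfl⟩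
  · rintro ⟨δ, rfl⟩
    exact ⟨δ.n, δ.r, δ.r₁, δ.r₂, δ.domain_eq, δ.volume_inter, δ.eqOn₁, δ.eqOn₂, rfl⟩

/-- An instance of move (1a) produces an element of `domainAddRel`.
[cite: KontsevichZagierPeriods2001, §1.2 rule (1)] -/
theorem DomainAddDatum.rel_mem (δ : DomainAddDatum) : δ.rel ∈ domainAddRel := by
  rw [domainAddRel_eq_range]; exact ⟨δ, rfl⟩

/-- **Data of an instance of move (1b), additivity in the integrand** (Kontsevich–Zagier 2001,
§1.2, rule (1)): `r`, `r₁`, `r₂` with the same domain and `f = f₁ + f₂` on it — verbatim the body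
of `KZ.integrandAddRel`. [cite: KontsevichZagierPeriods2001, §1.2 rule (1)] -/
structure IntegrandAddDatum where
  /-- The common dimension. -/
  n : ℕ
  /-- The representation being split. -/
  r : IntegralRep n
  /-- The first summand. -/
  r₁ : IntegralRep n
  /-- The second summand. -/
  r₂ : IntegralRep n
  /-- Same domain. -/
  domain_eq₁ : r₁.domain = r.domain
  /-- Same domain. -/
  domain_eq₂ : r₂.domain = r.domain
  /-- `f = f₁ + f₂` on the domain. -/
  eqOn : EqOn r.integrand (r₁.integrand + r₂.integrand) r.domain

/-- The relation `[r] − [r₁] − [r₂]` produced by an instance of move (1b).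
[cite: KontsevichZagierPeriods2001, §1.2 rule (1)] -/
def IntegrandAddDatum.rel (δ : IntegrandAddDatum) : FormalRep := of δ.r - of δ.r₁ - of δ.r₂

/-- The move set (1b) is the range of `IntegrandAddDatum.rel`.
[cite: KontsevichZagierPeriods2001, §1.2 rule (1)] -/
theorem integrandAddRel_eq_range : integrandAddRel = Set.range IntegrandAddDatum.rel := by
  ext c
  constructor
  · rintro ⟨n, r, r₁, r₂, h₁, h₂, h₃, rfl⟩
    exact ⟨⟨n, r, r₁, r₂, h₁, h₂, h₃⟩, rfl⟩
  · rintro ⟨δ, rfl⟩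
    exact ⟨δ.n, δ.r, δ.r₁, δ.r₂, δ.domain_eq₁, δ.domain_eq₂, δ.eqOn, rfl⟩

/-- An instance of move (1b) produces an element of `integrandAddRel`.
[cite: KontsevichZagierPeriods2001, §1.2 rule (1)] -/
theorem IntegrandAddDatum.rel_mem (δ : IntegrandAddDatum) : δ.rel ∈ integrandAddRel := by
  rw [integrandAddRel_eq_range]; exact ⟨δ, rfl⟩

/-- **Data of an instance of move (2), change of variables** (Kontsevich–Zagier 2001, §1.2,
rule (2)): `r`, `r'`, a `ℚ`-semialgebraic map `Φ` on `σ = r.domain`, injective on `σ`, with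
derivative `Φ' x` within `σ`, `σ' = Φ '' σ` and `f x = f' (Φ x) · |det Φ' x|` on `σ` — verbatim the
body of `KZ.changeOfVariablesRel`. [cite: KontsevichZagierPeriods2001, §1.2 rule (2)] -/
structure ChangeOfVariablesDatum where
  /-- The common dimension. -/
  n : ℕ
  /-- The source representation. -/
  r : IntegralRep n
  /-- The target representation. -/
  r' : IntegralRep n
  /-- The change of variables. -/
  Φ : (Fin n → ℝ) → (Fin n → ℝ)
  /-- Its derivative within the domain. -/
  Φ' : (Fin n → ℝ) → (Fin n → ℝ) →L[ℝ] (Fin n → ℝ)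
  /-- `Φ` is `ℚ`-semialgebraic on `σ`. -/
  isSemialgebraicMapOn : IsSemialgebraicMapOn ℚ r.domain Φ
  /-- `Φ' x` is the derivative of `Φ` within `σ` at `x ∈ σ`. -/
  hasFDerivWithinAt : ∀ x ∈ r.domain, HasFDerivWithinAt Φ (Φ' x) r.domain x
  /-- `Φ` is injective on `σ`. -/
  injOn : InjOn Φ r.domain
  /-- `σ' = Φ(σ)`. -/
  domain_eq : r'.domain = Φ '' r.domain
  /-- The change-of-variables formula for the integrands. -/
  integrand_eq : ∀ x ∈ r.domain, r.integrand x = r'.integrand (Φ x) * |(Φ' x).det|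

/-- The relation `[r] − [r']` produced by an instance of move (2).
[cite: KontsevichZagierPeriods2001, §1.2 rule (2)] -/
def ChangeOfVariablesDatum.rel (δ : ChangeOfVariablesDatum) : FormalRep := of δ.r - of δ.r'

/-- The move set (2) is the range of `ChangeOfVariablesDatum.rel`.
[cite: KontsevichZagierPeriods2001, §1.2 rule (2)] -/
theorem changeOfVariablesRel_eq_range :
    changeOfVariablesRel = Set.range ChangeOfVariablesDatum.rel := by
  ext c
  constructor
  · rintro ⟨n, r, r', Φ, Φ', h₁, h₂, h₃, h₄, h₅, rfl⟩
    exact ⟨⟨n, r, r', Φ, Φ', h₁, h₂, h₃, h₄, h₅⟩, rfl⟩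
  · rintro ⟨δ, rfl⟩
    exact ⟨δ.n, δ.r, δ.r', δ.Φ, δ.Φ', δ.isSemialgebraicMapOn, δ.hasFDerivWithinAt, δ.injOn,
      δ.domain_eq, δ.integrand_eq, rfl⟩

/-- An instance of move (2) produces an element of `changeOfVariablesRel`.
[cite: KontsevichZagierPeriods2001, §1.2 rule (2)] -/
theorem ChangeOfVariablesDatum.rel_mem (δ : ChangeOfVariablesDatum) :
    δ.rel ∈ changeOfVariablesRel := by
  rw [changeOfVariablesRel_eq_range]; exact ⟨δ, rfl⟩

/-- **Data of an instance of move (3), Newton–Leibniz along the last coordinate**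
(Kontsevich–Zagier 2001, §1.2, rule (3), in the precise fibrewise form of `KZ.newtonLeibnizRel`):
`r` in dimension `n + 1` over the base `r'` in dimension `n`, band functions `a ≤ b` on the base,
the band domain, a primitive `F` of the integrand along the fibres, continuous on the closed and
differentiable on the open fibres, and `r'.integrand x = F (x, b x) − F (x, a x)` — verbatim the
body of `KZ.newtonLeibnizRel`. [cite: KontsevichZagierPeriods2001, §1.2 rule (3)] -/
structure NewtonLeibnizDatum where
  /-- The base dimension. -/
  n : ℕ
  /-- The representation on the band (dimension `n + 1`). -/
  r : IntegralRep (n + 1)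
  /-- The base representation (dimension `n`). -/
  r' : IntegralRep n
  /-- The lower band function. -/
  a : (Fin n → ℝ) → ℝ
  /-- The upper band function. -/
  b : (Fin n → ℝ) → ℝ
  /-- The primitive. -/
  F : (Fin (n + 1) → ℝ) → ℝ
  /-- `F` is `ℚ`-semialgebraic on the band. -/
  isSemialgebraicFunOn_F : IsSemialgebraicFunOn ℚ r.domain F
  /-- `a` is `ℚ`-semialgebraic on the base. -/
  isSemialgebraicFunOn_a : IsSemialgebraicFunOn ℚ r'.domain a
  /-- `b` is `ℚ`-semialgebraic on the base. -/
  isSemialgebraicFunOn_b : IsSemialgebraicFunOn ℚ r'.domain b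
  /-- `a ≤ b` on the base. -/
  a_le_b : ∀ x ∈ r'.domain, a x ≤ b x
  /-- The band domain. -/
  domain_eq : r.domain = {z | (Fin.init z : Fin n → ℝ) ∈ r'.domain ∧
    a (Fin.init z) ≤ z (Fin.last n) ∧ z (Fin.last n) ≤ b (Fin.init z)}
  /-- `F` is continuous on the closed fibres. -/
  continuousOn : ∀ x ∈ r'.domain, ContinuousOn (fun t : ℝ => F (Fin.snoc x t)) (Icc (a x) (b x))
  /-- `F` is a primitive of the integrand on the open fibres. -/
  hasDerivAt : ∀ x ∈ r'.domain, ∀ t ∈ Ioo (a x) (b x),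
    HasDerivAt (fun s : ℝ => F (Fin.snoc x s)) (r.integrand (Fin.snoc x t)) t
  /-- The Newton–Leibniz formula for the base integrand. -/
  integrand_eq : ∀ x ∈ r'.domain, r'.integrand x = F (Fin.snoc x (b x)) - F (Fin.snoc x (a x))

/-- The relation `[r] − [r']` produced by an instance of move (3).
[cite: KontsevichZagierPeriods2001, §1.2 rule (3)] -/
def NewtonLeibnizDatum.rel (δ : NewtonLeibnizDatum) : FormalRep := of δ.r - of δ.r'

/-- The move set (3) is the range of `NewtonLeibnizDatum.rel`.
[cite: KontsevichZagierPeriods2001, §1.2 rule (3)] -/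
theorem newtonLeibnizRel_eq_range : newtonLeibnizRel = Set.range NewtonLeibnizDatum.rel := by
  ext c
  constructor
  · rintro ⟨n, r, r', a, b, F, h₁, h₂, h₃, h₄, h₅, h₆, h₇, h₈, rfl⟩
    exact ⟨⟨n, r, r', a, b, F, h₁, h₂, h₃, h₄, h₅, h₆, h₇, h₈⟩, rfl⟩
  · rintro ⟨δ, rfl⟩
    exact ⟨δ.n, δ.r, δ.r', δ.a, δ.b, δ.F, δ.isSemialgebraicFunOn_F, δ.isSemialgebraicFunOn_a,
      δ.isSemialgebraicFunOn_b, δ.a_le_b, δ.domain_eq, δ.continuousOn, δ.hasDerivAt,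
      δ.integrand_eq, rfl⟩

/-- An instance of move (3) produces an element of `newtonLeibnizRel`.
[cite: KontsevichZagierPeriods2001, §1.2 rule (3)] -/
theorem NewtonLeibnizDatum.rel_mem (δ : NewtonLeibnizDatum) : δ.rel ∈ newtonLeibnizRel := by
  rw [newtonLeibnizRel_eq_range]; exact ⟨δ, rfl⟩

/-- **A move instance of the KZ calculus**: the data of one instance of one of the four moves
(1a), (1b), (2), (3) (Kontsevich–Zagier 2001, §1.2). [cite: KontsevichZagierPeriods2001, §1.2] -/
inductive MoveDatum
  /-- An instance of (1a), additivity in the domain. -/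
  | domainAdd (δ : DomainAddDatum)
  /-- An instance of (1b), additivity in the integrand. -/
  | integrandAdd (δ : IntegrandAddDatum)
  /-- An instance of (2), change of variables. -/
  | changeOfVariables (δ : ChangeOfVariablesDatum)
  /-- An instance of (3), Newton–Leibniz. -/
  | newtonLeibniz (δ : NewtonLeibnizDatum)

/-- The relation produced by a move instance. [cite: KontsevichZagierPeriods2001, §1.2] -/
def MoveDatum.rel : MoveDatum → FormalRep
  | .domainAdd δ => δ.rel
  | .integrandAdd δ => δ.rel
  | .changeOfVariables δ => δ.rel
  | .newtonLeibniz δ => δ.rel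

/-- The relations produced by the move instances are exactly the four move sets.
[cite: KontsevichZagierPeriods2001, §1.2] -/
theorem range_moveDatumRel :
    Set.range MoveDatum.rel =
      domainAddRel ∪ integrandAddRel ∪ changeOfVariablesRel ∪ newtonLeibnizRel := by
  rw [domainAddRel_eq_range, integrandAddRel_eq_range, changeOfVariablesRel_eq_range,
    newtonLeibnizRel_eq_range]
  ext c
  simp only [Set.mem_range, Set.mem_union]
  constructor
  · rintro ⟨δ, rfl⟩
    rcases δ with δ | δ | δ | δ
    · exact Or.inl (Or.inl (Or.inl ⟨δ, rfl⟩))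
    · exact Or.inl (Or.inl (Or.inr ⟨δ, rfl⟩))
    · exact Or.inl (Or.inr ⟨δ, rfl⟩)
    · exact Or.inr ⟨δ, rfl⟩
  · rintro (((⟨δ, rfl⟩ | ⟨δ, rfl⟩) | ⟨δ, rfl⟩) | ⟨δ, rfl⟩)
    · exact ⟨.domainAdd δ, rfl⟩
    · exact ⟨.integrandAdd δ, rfl⟩
    · exact ⟨.changeOfVariables δ, rfl⟩
    · exact ⟨.newtonLeibniz δ, rfl⟩

/-- Every move instance produces a relation of the calculus. [cite: KontsevichZagierPeriods2001, §1.2] -/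
theorem MoveDatum.rel_mem_relations (δ : MoveDatum) : δ.rel ∈ relations := by
  refine AddSubgroup.subset_closure ?_
  rw [← range_moveDatumRel]
  exact ⟨δ, rfl⟩

/-- `KZ.relations` is the subgroup generated by the relations of all move instances.
[cite: KontsevichZagierPeriods2001, §1.2] -/
theorem relations_eq_closure_range :
    relations = AddSubgroup.closure (Set.range MoveDatum.rel) := by
  rw [range_moveDatumRel]; rfl

/-! ### Sub-calculi generated by admissible move instances -/

/-- **The sub-calculus generated by a family of admissible move instances**: the subgroup of
`FormalRep` generated by the relations `δ.rel` of the move instances `δ ∈ adm`. With `adm` = "all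
data of `δ` have arrangement conductor `⊆ S`" this is the requested `KZ_S` (D2 of the route
`PeriodConductors`); with `adm = univ` it is `KZ.relations` (`localRelationsOf_univ`). [folklore] -/
def localRelationsOf (adm : Set MoveDatum) : AddSubgroup FormalRep :=
  AddSubgroup.closure (MoveDatum.rel '' adm)

/-- An admissible instance's relation lies in the sub-calculus. [folklore] -/
theorem rel_mem_localRelationsOf {adm : Set MoveDatum} {δ : MoveDatum} (h : δ ∈ adm) :
    δ.rel ∈ localRelationsOf adm :=
  AddSubgroup.subset_closure ⟨δ, h, rfl⟩

/-- Every sub-calculus is contained in the full calculus: `localRelationsOf adm ≤ relations`.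
[folklore] -/
theorem localRelationsOf_le_relations (adm : Set MoveDatum) : localRelationsOf adm ≤ relations := by
  rw [relations_eq_closure_range]
  exact AddSubgroup.closure_mono (Set.image_subset_range _ _)

/-- Sub-calculi are monotone in the admissible family. [folklore] -/
theorem localRelationsOf_mono {adm adm' : Set MoveDatum} (h : adm ⊆ adm') :
    localRelationsOf adm ≤ localRelationsOf adm' :=
  AddSubgroup.closure_mono (Set.image_mono h)

/-- All instances admissible: the full calculus. [folklore] -/
theorem localRelationsOf_univ : localRelationsOf Set.univ = relations := by
  rw [localRelationsOf, Set.image_univ, relations_eq_closure_range]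

/-- No instance admissible: the trivial sub-calculus. [folklore] -/
theorem localRelationsOf_empty : localRelationsOf ∅ = ⊥ := by
  simp [localRelationsOf]

/-- **Sub-calculi of a union**: the sub-calculus of `⋃ᵢ adm i` is the supremum of the
sub-calculi of the `adm i` (Mathlib `AddSubgroup.closure_iUnion`). [folklore] -/
theorem localRelationsOf_iUnion {ι : Sort*} (adm : ι → Set MoveDatum) :
    localRelationsOf (⋃ i, adm i) = ⨆ i, localRelationsOf (adm i) := by
  rw [localRelationsOf, Set.image_iUnion, AddSubgroup.closure_iUnion]
  rfl

/-- **Local equivalence**: two integral representations are equivalent *through admissible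
moves* if `[r] − [r'] ∈ localRelationsOf adm` (for `adm = univ` this is `KZ.Equivalent`).
[folklore] -/
def LocallyEquivalentOf (adm : Set MoveDatum) {n m : ℕ} (r : IntegralRep n) (r' : IntegralRep m) :
    Prop :=
  of r - of r' ∈ localRelationsOf adm

namespace LocallyEquivalentOf

variable {adm adm' : Set MoveDatum} {n m l : ℕ}

/-- Local equivalence is reflexive. [folklore] -/
protected theorem refl (adm : Set MoveDatum) (r : IntegralRep n) : LocallyEquivalentOf adm r r := by
  simp [LocallyEquivalentOf, (localRelationsOf adm).zero_mem]

/-- Local equivalence is symmetric. [folklore] -/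
protected theorem symm {r : IntegralRep n} {r' : IntegralRep m} (h : LocallyEquivalentOf adm r r') :
    LocallyEquivalentOf adm r' r := by
  simpa [LocallyEquivalentOf] using (localRelationsOf adm).neg_mem h

/-- Local equivalence is transitive. [folklore] -/
protected theorem trans {r : IntegralRep n} {r' : IntegralRep m} {r'' : IntegralRep l}
    (h : LocallyEquivalentOf adm r r') (h' : LocallyEquivalentOf adm r' r'') :
    LocallyEquivalentOf adm r r'' := by
  simpa [LocallyEquivalentOf] using (localRelationsOf adm).add_mem h h'

/-- Local equivalence is monotone in the admissible family. [folklore] -/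
theorem mono {r : IntegralRep n} {r' : IntegralRep m} (h : LocallyEquivalentOf adm r r')
    (hadm : adm ⊆ adm') :
    LocallyEquivalentOf adm' r r' :=
  localRelationsOf_mono hadm h

/-- Locally equivalent representations are equivalent in the full calculus. [folklore] -/
theorem equivalent {r : IntegralRep n} {r' : IntegralRep m} (h : LocallyEquivalentOf adm r r') :
    Equivalent r r' :=
  localRelationsOf_le_relations adm h

end LocallyEquivalentOf

/-- Equivalence in the full calculus is local equivalence for `adm = univ`. [folklore] -/
theorem locallyEquivalentOf_univ_iff {n m : ℕ} {r : IntegralRep n} {r' : IntegralRep m} :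
    LocallyEquivalentOf Set.univ r r' ↔ Equivalent r r' := by
  rw [LocallyEquivalentOf, localRelationsOf_univ, Equivalent]

/-! ### Conductor-indexed sub-calculi (`KZ_S` for an arbitrary conductor of move data) -/

/-- **The sub-calculus over `Spec ℤ[1/S]` for a conductor-like invariant `cond` of move data**:
generated by the move instances `δ` with `cond δ ⊆ S`. D2 of the route `PeriodConductors` is the
case `cond` = arrangement conductor of all the data of `δ` (request D1, general level; not yet in
the tree), i.e. `KZ.localRelations S = localRelationsOfConductor arrangementConductor S`.
[folklore] -/
def localRelationsOfConductor (cond : MoveDatum → Set ℕ) (S : Finset ℕ) : AddSubgroup FormalRep :=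
  localRelationsOf {δ | cond δ ⊆ ↑S}

/-- `KZ_S ≤ KZ`: a conductor-indexed sub-calculus is contained in the full calculus. [folklore] -/
theorem localRelationsOfConductor_le_relations (cond : MoveDatum → Set ℕ) (S : Finset ℕ) :
    localRelationsOfConductor cond S ≤ relations :=
  localRelationsOf_le_relations _

/-- `KZ_S` is monotone in `S`. [folklore] -/
theorem localRelationsOfConductor_mono (cond : MoveDatum → Set ℕ) {S S' : Finset ℕ} (h : S ⊆ S') :
    localRelationsOfConductor cond S ≤ localRelationsOfConductor cond S' :=
  localRelationsOf_mono fun _ hδ => hδ.trans (Finset.coe_subset.2 h)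

/-- A move instance with conductor inside `S` yields a relation of `KZ_S`. [folklore] -/
theorem rel_mem_localRelationsOfConductor {cond : MoveDatum → Set ℕ} {S : Finset ℕ} {δ : MoveDatum}
    (h : cond δ ⊆ ↑S) : δ.rel ∈ localRelationsOfConductor cond S :=
  rel_mem_localRelationsOf h

/-- **`⋃_S KZ_S = KZ` when every move instance has a finite conductor**: the supremum over all
finite `S` of the conductor-indexed sub-calculi is the full calculus (every instance is admissible
for `S ⊇ cond δ`). [folklore] -/
theorem iSup_localRelationsOfConductor (cond : MoveDatum → Set ℕ) (hfin : ∀ δ, (cond δ).Finite) :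
    (⨆ S : Finset ℕ, localRelationsOfConductor cond S) = relations := by
  refine le_antisymm (iSup_le fun S => localRelationsOfConductor_le_relations cond S) ?_
  rw [relations_eq_closure_range, AddSubgroup.closure_le]
  rintro _ ⟨δ, rfl⟩
  have h : δ.rel ∈ localRelationsOfConductor cond (hfin δ).toFinset :=
    rel_mem_localRelationsOfConductor (by rw [Set.Finite.coe_toFinset])
  exact (le_iSup (fun S : Finset ℕ => localRelationsOfConductor cond S) (hfin δ).toFinset) h

end KZ

end Literature.NumberTheory.Transcendental
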